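import Literature.MathematicalPhysics.KineticTheory.HydrodynamicLimitsMomentsProofs
import HarnessLib

/-!
# `moments_infinitesimalMaxwellian`: false as vendored; the corrected (Borel) named fact

Third companion file of `Literature/MathematicalPhysics/KineticTheory/HydrodynamicLimits.lean`
(statement **hilbert6.S15**), about the named fact
`Literature.MathematicalPhysics.KineticTheory.moments_infinitesimalMaxwellian`: for the
infinitesimal Maxwellian `g = ρ + u·v + θ (|v|² - d)/2` (Bardos–Golse–Levermore, J. Stat. Phys. 63
(1991) §4, eq. (39) p. 334, written there for `D = 3` as `g = ρ + v·u + (½|v|² - 3/2) θ`;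
general `D`: Bardos–Golse–Levermore, CPAM 46 (1993), Prop. 2.1 (3), eq. (2.7) p. 682) the
hydrodynamic moments against the Maxwellian `M dv = stdGaussian E` recover the fluid variables,
`⟨g⟩ = ρ`, `⟨v g⟩ = u`, `⟨(|v|²/d - 1) g⟩ = θ` — the computation used on p. 335 of BGL 1991
("When `g` is replaced by the right side of (39) these become (40)"). The sibling file
`HydrodynamicLimitsMomentsProofs.lean` proves this for the **Borel** σ-algebra of the velocity
space (`moments_infinitesimalMaxwellian_of_borelSpace`, under the extra instance `[BorelSpace E]`)
and explains why the extra instance is needed. This file makes the status of the fact itself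
kernel-visible and vendors its corrected form:

1. **The fact as vendored is false** (`not_moments_infinitesimalMaxwellian_bot`,
   `moments_infinitesimalMaxwellian_false`). `moments_infinitesimalMaxwellian` is a
   `def … : Prop` produced by the M5 mechanical defacting of a theorem living in a section with
   `variable … [MeasurableSpace E] [BorelSpace E]`; a *theorem* there includes the instance
   hypothesis `[BorelSpace E]` automatically, a *definition* keeps only the section variables its
   body mentions — and the body (three integrals against `stdGaussian E`) mentions
   `[MeasurableSpace E]` but not `[BorelSpace E]` (`#check` prints
   `… → [FiniteDimensional ℝ E] → [MeasurableSpace E] → Prop`). So the Prop speaks about an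
   ARBITRARY σ-algebra on `E`. On the trivial σ-algebra `⊥` every real integrand taking two
   distinct values has Bochner integral `0` against every measure
   (`integral_eq_zero_of_forall_measurableSet`: a strongly measurable function is then constant, and
   an a.e.-modification of a constant is literally constant on a set of full outer measure, i.e.
   everywhere); with `X = Unit`, `(ρ, u, θ) = (0, 0, 1)` the temperature conjunct of the fact reads
   `∫ (|v|²/d - 1)(|v|² - d)/2 dγ = 1`, whose integrand is `d/2` at `v = 0` and `0` at `|v|² = d`:
   contradiction. Hence NO term `moments_infinitesimalMaxwellian_holds : moments_infinitesimalMaxwellian`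
   can exist, on any axioms short of `False`.
2. **The corrected named fact** `moments_infinitesimalMaxwellian_borel`: the same statement with
   the Borel hypothesis — implicit in the source, whose velocity space is `ℝ^D` with Lebesgue
   measure — bound explicitly (`∀ … [BorelSpace E], …`, the idiom of
   `Literature.Analysis.FunctionSpaces.SobolevTrace`), written as a CLOSED Prop (position space
   `X` and velocity space `E` quantified inside) so that its discharge is literally
   `theorem moments_infinitesimalMaxwellian_borel_holds : moments_infinitesimalMaxwellian_borel`;
   the discharge is the sibling's `moments_infinitesimalMaxwellian_of_borelSpace` (second and
   fourth Gaussian moments, odd moments vanish).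

Nothing else of `HydrodynamicLimits.lean` is affected: its other abstract-`E` facts
(`AEBoussinesqMaxwellian.moments_ae`, the BGL statements) mention `volume` on `E` and therefore do
carry `[BorelSpace E]`; the Golse–Saint-Raymond / BGL / Deng–Hani–Ma statements live on
`EuclideanSpace ℝ (Fin d)` with its canonical instances.

## References

* C. Bardos, F. Golse, D. Levermore, *Fluid dynamic limits of kinetic equations. I. Formal
  derivations*, J. Stat. Phys. 63 (1991) 323–344 (bib key `BGLFluidDynamicLimitsI1991`, the full
  entry behind the interim stubs `BGL1991` / `BardosGolseLevermore1991`): §4, eqs. (37)–(40)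
  p. 334 and p. 335. Locators and the two quotations above are read from the held corpus copy
  `paper:doi-10-1007-bf01026608` (doi:10.1007/bf01026608; PDF pp. 12–13 = journal pp. 334–335:
  Theorem III with (37)–(40) on p. 334, its proof with (45)–(48) and "When `g` is replaced by the
  right side of (39) these become (40)" on p. 335). The paper numbers its equations (1), (2), …
  consecutively; the locator "(3.10), (3.14)" in the docstring of the vendored
  `moments_infinitesimalMaxwellian` does not exist in it.
* C. Bardos, F. Golse, C. D. Levermore, *Fluid dynamic limits of kinetic equations II*, Comm. Pure
  Appl. Math. 46 (1993) 667–753: (1.45) p. 675 (`N(L)` = infinitesimal Maxwellians), Prop. 2.1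
  (3) eq. (2.7) p. 682.
-/

open MeasureTheory ProbabilityTheory Module
open scoped InnerProductSpace RealInnerProductSpace

noncomputable section

namespace Literature.MathematicalPhysics.KineticTheory

/-! ### The corrected named fact and its discharge -/

section Corrected

universe u v

/-- **hilbert6.S15, moments of an infinitesimal Maxwellian — corrected statement** of
`moments_infinitesimalMaxwellian` (same source). For the infinitesimal Maxwellian
`g = ρ + u·v + θ (|v|² - d)/2` (Bardos–Golse–Levermore 1991, §4 eq. (39) p. 334, there with
`D = 3`; general `D`: Bardos–Golse–Levermore 1993, Prop. 2.1 (3), eq. (2.7) p. 682) on a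
finite-dimensional real inner product space `E` of dimension `d ≥ 1` **with its Borel σ-algebra**,
the hydrodynamic moments against `M dv = stdGaussian E` recover the fluid variables:
`⟨g⟩ = ρ` (`densityFluct`), `⟨v g⟩ = u` (`bulkVelocity`), `⟨(|v|²/d - 1) g⟩ = θ`
(`temperatureFluct`) — the computation behind BGL 1991 p. 335 ("When `g` is replaced by the right
side of (39) these become (40)").

**Discrepancy with the vendored `moments_infinitesimalMaxwellian`.** That `def … : Prop` was
produced mechanically (M5) from a theorem of a section with `[MeasurableSpace E] [BorelSpace E]`;
as a definition it kept only the section variables its body uses and so silently dropped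
`[BorelSpace E]`, i.e. it quantifies over an *arbitrary* σ-algebra on the velocity space, for which
`stdGaussian E` is not the Gaussian law; it is false (`moments_infinitesimalMaxwellian_false`).
Here the Borel hypothesis is bound explicitly and the statement is CLOSED (`X`, `E` and its
structure are quantified inside the Prop, where the vendored def had them as implicit
parameters); the body is otherwise verbatim. Discharged by
`moments_infinitesimalMaxwellian_borel_holds`; use as
`moments_infinitesimalMaxwellian_borel_holds hE ρ u θ x`.
[cite: BGLFluidDynamicLimitsI1991, §4 Eq. (39) p. 334 and p. 335] -/
def moments_infinitesimalMaxwellian_borel : Prop :=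
  ∀ {X : Type u} {E : Type v} [NormedAddCommGroup E] [InnerProductSpace ℝ E] [FiniteDimensional ℝ E]
    [MeasurableSpace E] [BorelSpace E] (_hE : 0 < finrank ℝ E)
    (ρ : X → ℝ) (u : X → E) (θ : X → ℝ) (x : X),
    let g : X → E → ℝ := fun x v => ρ x + ⟪u x, v⟫ + θ x * (‖v‖ ^ 2 - finrank ℝ E) / 2
    Literature.Analysis.FluidPDE.densityFluct g x = ρ x ∧
      Literature.Analysis.FluidPDE.bulkVelocity g x = u x ∧
      Literature.Analysis.FluidPDE.temperatureFluct g x = θ x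

/-- **Discharge of `moments_infinitesimalMaxwellian_borel`**: it is, pointwise in
`(X, E, ρ, u, θ, x)`, the sibling theorem `moments_infinitesimalMaxwellian_of_borelSpace`
(`HydrodynamicLimitsMomentsProofs.lean`: `⟨v ⊗ v⟩ = I`, `⟨(|v|² - d)²⟩ = 2d`, odd moments vanish;
BGL 1991 §4, (39)–(40), pp. 334–335).
[cite: BGLFluidDynamicLimitsI1991, §4 Eq. (39) p. 334 and p. 335] -/
theorem moments_infinitesimalMaxwellian_borel_holds : moments_infinitesimalMaxwellian_borel := by
  intro X E _ _ _ _ _ hE ρ u θ x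
  exact moments_infinitesimalMaxwellian_of_borelSpace (X := X) (E := E) hE ρ u θ x

end Corrected

/-! ### The vendored fact is false on a non-Borel σ-algebra -/

section Misstatement

/-- **Junk integrals on the trivial σ-algebra.** If the only measurable sets are `∅` and `univ`,
every real integrand taking two distinct values has Bochner integral `0` against every measure:
a strongly measurable function is then constant, an a.e.-modification of it is literally equal to
it on a set of full outer measure — i.e. everywhere, unless the measure vanishes — so a function
with two values is not a.e. strongly measurable and its integral is the junk value `0`.
[folklore] -/
theorem integral_eq_zero_of_forall_measurableSet {α : Type*} [MeasurableSpace α] {μ : Measure α}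
    (hbot : ∀ s : Set α, MeasurableSet s → s = ∅ ∨ s = Set.univ) {F : α → ℝ} {a b : α}
    (hab : F a ≠ F b) : ∫ x, F x ∂μ = 0 := by
  by_cases hμ : μ = 0
  · simp [hμ]
  refine integral_non_aestronglyMeasurable fun hF => ?_
  obtain ⟨G, hG, hFG⟩ := hF
  -- a strongly measurable `G` is constant
  have hconst : ∀ x, G x = G a := fun x => by
    have hs : MeasurableSet (G ⁻¹' {G a}) := hG.measurable (measurableSet_singleton _)
    have ha : a ∈ G ⁻¹' {G a} := Set.mem_preimage.2 (Set.mem_singleton _)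
    rcases hbot _ hs with h | h
    · rw [h] at ha
      simp at ha
    · have hx : x ∈ G ⁻¹' {G a} := by
        rw [h]
        exact Set.mem_univ x
      exact Set.mem_singleton_iff.1 hx
  -- the exceptional set `{F ≠ G}` contains `a` or `b`
  have hzero : μ {x | F x ≠ G x} = 0 := ae_iff.1 hFG
  have hnonempty : ({x | F x ≠ G x} : Set α).Nonempty := by
    by_contra h
    rw [Set.not_nonempty_iff_eq_empty, Set.eq_empty_iff_forall_notMem] at h
    have h1 : F a = G a := by simpa using h a
    have h2 : F b = G b := by simpa using h b
    exact hab (by rw [h1, h2, hconst b])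
  -- hence it has full, nonzero, outer measure
  have h1 : μ (toMeasurable μ {x | F x ≠ G x}) = μ {x | F x ≠ G x} := measure_toMeasurable _
  have h2 : toMeasurable μ {x | F x ≠ G x} = Set.univ := by
    rcases hbot _ (measurableSet_toMeasurable μ {x | F x ≠ G x}) with h | h
    · exact absurd (hnonempty.mono (subset_toMeasurable μ _)) (by
        rw [h]; exact Set.not_nonempty_empty)
    · exact h
  rw [← h1, h2, Measure.measure_univ_eq_zero] at hzero
  exact hμ hzero

/-- **`moments_infinitesimalMaxwellian` fails for the trivial σ-algebra.** On any nontrivial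
finite-dimensional real inner product space `E` equipped with the σ-algebra `⊥`, the vendored Prop
is false: with `X = Unit`, `(ρ, u, θ) = (0, 0, 1)` its third conjunct asserts
`∫ (|v|²/d - 1)(|v|² - d)/2 d(stdGaussian E) = 1`, but the integrand takes the values `d/2` at
`v = 0` and `0` at `|v|² = d`, so by `integral_eq_zero_of_forall_measurableSet` the integral is
the junk value `0`. (For the Borel σ-algebra the Prop holds:
`moments_infinitesimalMaxwellian_of_borelSpace`.) [folklore] -/
theorem not_moments_infinitesimalMaxwellian_bot {E : Type*} [NormedAddCommGroup E]
    [InnerProductSpace ℝ E] [FiniteDimensional ℝ E] [Nontrivial E] :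
    ¬ @moments_infinitesimalMaxwellian Unit E _ _ _ ⊥ := by
  letI : MeasurableSpace E := ⊥
  intro h
  have hd : 0 < finrank ℝ E := Module.finrank_pos
  have hd0 : (0 : ℝ) < finrank ℝ E := Nat.cast_pos.2 hd
  have h3 := (h hd 0 0 1 ()).2.2
  obtain ⟨e, he⟩ : ∃ e : E, ‖e‖ = 1 :=
    ⟨stdOrthonormalBasis ℝ E ⟨0, hd⟩, (stdOrthonormalBasis ℝ E).norm_eq_one _⟩
  have hbot : ∀ s : Set E, MeasurableSet s → s = ∅ ∨ s = Set.univ := fun s hs =>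
    MeasurableSpace.measurableSet_bot_iff.1 hs
  have hne : ‖(Real.sqrt (finrank ℝ E) • e : E)‖ ^ 2 = finrank ℝ E := by
    rw [norm_smul, he, mul_one, Real.norm_of_nonneg (Real.sqrt_nonneg _), Real.sq_sqrt hd0.le]
  have hint : Literature.Analysis.FluidPDE.temperatureFluct
      (fun (x : Unit) (v : E) =>
        (0 : Unit → ℝ) x + ⟪(0 : Unit → E) x, v⟫ + (1 : Unit → ℝ) x * (‖v‖ ^ 2 - finrank ℝ E) / 2)
      () = 0 := by
    unfold Literature.Analysis.FluidPDE.temperatureFluct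
    refine integral_eq_zero_of_forall_measurableSet hbot (a := (0 : E))
      (b := Real.sqrt (finrank ℝ E) • e) ?_
    simp only [hne, norm_zero, Pi.zero_apply, Pi.one_apply, inner_zero_left, div_self hd0.ne']
    norm_num
    exact hd.ne'
  have key : (0 : ℝ) = (1 : Unit → ℝ) () := hint.symm.trans h3
  simp at key

/-- **`moments_infinitesimalMaxwellian` is false as a named fact** (closed witness): for
`X = Unit`, `E = ℝ` with the trivial σ-algebra `⊥` (a legitimate instance of its free
`[MeasurableSpace E]` binder) the Prop fails, so no term
`moments_infinitesimalMaxwellian_holds : moments_infinitesimalMaxwellian` exists; the corrected,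
discharged statement is `moments_infinitesimalMaxwellian_borel` (and, under the old name with the
extra instance `[BorelSpace E]`, `moments_infinitesimalMaxwellian_of_borelSpace`). [folklore] -/
theorem moments_infinitesimalMaxwellian_false :
    ¬ @moments_infinitesimalMaxwellian Unit ℝ _ _ _ ⊥ :=
  not_moments_infinitesimalMaxwellian_bot

end Misstatement

end Literature.MathematicalPhysics.KineticTheory
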